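import Mathlib
import HarnessLib
import Summits.HubbardSuperconductivity.HubbardSuperconductivity.Theorems.KLProgrammeKLRegimeEnginePairTransferOutClassSameFrameBorn
import Summits.HubbardSuperconductivity.HubbardSuperconductivity.Theorems.KLProgrammeKLRegimeEnginePairTransferOutClassLattice

/-!
# Route `KLProgramme` — ENGINE item stmt-HubbardSuperconductivity-20437 `KLRegimeEngineV17F2`, stub (c) value lane, «(c)-OUT» CLOSER:
# the same-frame out-of-class increment BOOKED INTO THE BARS OF (E2″-F)ₙ₊₁ under the (R231) default slot shares, and its hsame-shaped reading
# (cell gate-hubbard-kl, seat hubbard-kl-k3c2-p2 g19; recipe HOME/hubbard-kl-k3c2-p2/OUT-OF-CLASS-E2.md §7; shares: cell STATUS (R231), plan g23 16:36Z)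

The capstone `outClass_sameFrame_le_slots_signedBorn` (…OutClassSameFrameBorn, p648001) bounds the un-resummed slice increment of a member pair array
out of the pair class by `(Λₙ−Λₙ₊₁)·½RH + RL + gainBar + thermalBar + 4·LAT₀/L + 2εC + (ZS₀ˢ·Λₙ₊₁ + 2·LAT₀ˢ/L + 2εˢC)`, `C = 2048·15367`.
The out-of-class bracket of (E2″-F)ₙ₊₁ (`hsame` of `stepValuesV17F2_of_residue_sameFrame_Q`) is `gainBar … (n+1) + eremBar G P Q U β L n + thermalBar … (n+1) + legDressBarQ2`,
`eremBar G P Q U β L n = (α) G.cloc·(Klam U)²·4^{−θn} + (β) Q.CR·(Klam|U|)³·2⁻ⁿ + (γ) Q.CL β n/L` (…SplitConsts).  (R231) DEFAULT SHARES (pen, 2026-08-28 16:36Z):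
(α) Hd row `(Λₙ−Λₙ₊₁)·½RH ≤ ½(α)`, the other half for the ε-terms; (β) born main `ZS₀ˢ·Λₙ₊₁ ≤ ½(β)`, the other half reserved for the ε-terms;
(γ) `RL ≤ ½(γ)`, lattice `4·LAT₀/L + 2·LAT₀ˢ/L ≤ ½(γ)`; the ε-terms take exactly ONE of the two reserved halves.
* §1 the shares' ARITHMETIC (model-free): `residue_le_eremBar_of_shares` — the five residue terms at these shares sum to `≤ eremBar G P Q U β L n`; the ε-terms
  are taken in the ENVELOPE `≤ ½(α) + ½(β)`, which either (R231)-compliant choice implies (`eps_envelope_of_alpha_half`, `eps_envelope_of_beta_half`);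
* §2 the two (E4)-sized shares: `latticeTerms_eq_combined` + `latticeTerms_div_le_half_CL` (generic `Q`: `4·LAT₀/L + 2·LAT₀ˢ/L ≤ ½·Q.CL β n/L` from
  `(β²+1)·(2¹⁸(L_A + L_Aˢ/2) + 2³⁰(A₀ + A₀ˢ/2)·G·16^{j−(n+1)}) ≤ ½·Q.CL β n`, via `latticeTerm_le_of_regime` at the combined data), `bornMain_le_half_CR`
  (`ZS₀ˢ·klE0 ≤ 2·Q.CR·(Klam|U|)³ ⇒ ZS₀ˢ·Λₙ₊₁ ≤ ½(β)`, = `born_main_le_CR_slot` at `s = ½`), and the lattice demand from the two SIZE inequalities of (R231)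
  `L_A + L_Aˢ/2 ≤ 2³⁹·Psq²Rsq²`, `(A₀ + A₀ˢ/2)·G ≤ 2²⁷·Psq²Rsq²` for any `Q` with `(klEngQ9c P R).CL β n ≤ Q.CL β n` (`latticeDemand_of_sizes`, member index `j = n+1`);
* §3 **`outClass_sameFrame_le_bars`** — the capstone's binders verbatim + `Q : EngConsts` with `0 ≤ Q.CR` + the four share hypotheses ⇒
  `‖A_j(1) − A_j(0)‖(x,y) ≤ gainBar klEngGeo11 P U (n+1) ρpp ρd ρx + eremBar klEngGeo11 P Q U β L n + thermalBar klEngGeo11 P U β (n+1)`,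
  every `n ≤ n_β`, every out-of-class `Qm`, every `(x, y)`, every member index `j ≥ n+1`;
* (companion file …OutClassE2Shape) the hsame SHAPE at the plain index `j = n+1`: `outClass_endpoints_eq_plain` identifies the endpoints of the capstone's curve on the bare ball
  (`A_{n+1}(1)(x,y) = klPairAmplitude K (n+1) Qm x y`, `A_{n+1}(0)(x,y) = 𝒞ₙ[K; softCovOf K s_{n,n+1}](Qm,x,y)`, by `klmf_memberArray_flowData` (3)(4),
  `softSymbolCompl_self`, `softCovOf_zero`, `klCovSmearedPairAmplitude_zero`), and **`outClass_sameFrame_le_E2shape`** adds the un-smearing step (iii) as ONE binder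
  `‖𝒞ₙ[K; softCovOf K s_{n,n+1}](Qm,x,y) − klPairAmplitude K n Qm x y‖ ≤ legDressBarQ2 klEngGeo11 P Q U (n+1) (legSliceCountT L β μ K (n+1) ![y, Qm−y, Qm−x, x])`
  ((R211) Q2's slot) to conclude LITERALLY the summand of `hsame` at `(G, N) = (klEngGeo11, n+1)`:
  `‖klPairAmplitude K (n+1) Qm x y − klPairAmplitude K n Qm x y‖ ≤ gainBar … + eremBar … n + thermalBar … (n+1) + legDressBarQ2 …` (frame `K` generic; `K := klFlowFrameU … (n+1)`,
  the frame-window one-liners `signedRows_frameWindow_of_regime` and the `∀ Qm k k'` wrapper are the consumer's).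
What is still a binder BY NAME (OUT-OF-CLASS-E2.md §7): `RH`, `RL` (k3c1-p1's Hd/LOC rows); the dressed-moment data `(A₀, L_A, ε)`, `(A₀ˢ, L_Aˢ, εˢ)` with the
five kernel SIZE inequalities and the three share inequalities above («(E4)-DRESSED-MOMENTS»); the un-smearing bound (iii); outside the file the frame shift (F)(i).
Composition and arithmetic only; nothing about the model's sizes is asserted; nothing asserts (E2″-F), (c), K3 or superconductivity.  0 kit · 0 lit.
-/

noncomputable section

namespace Summit.HubbardSuperconductivity.HubbardSuperconductivity.Theorems.KLRegimeSplit

set_option linter.dupNamespace false -- summit = problem name (single-conjunct summit), D-0017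

open Real Set Finset Complex Matrix Literature.MathematicalPhysics.QuantumLattice GrassmannAlgebra
open Literature.Probability.LatticeModels hiding torusSupNorm
open Literature.MathematicalPhysics.QuantumLattice.BandSectorCounting
open Summit.HubbardSuperconductivity.HubbardSuperconductivity.Theorems.KLProgrammeLegKernels
open Summit.HubbardSuperconductivity.HubbardSuperconductivity.Theorems.KLRegimeWick
open Summit.HubbardSuperconductivity.HubbardSuperconductivity.Theorems.TwoPointAssembly
open Summit.HubbardSuperconductivity.HubbardSuperconductivity.Theorems.EngineV8
open Summit.HubbardSuperconductivity.HubbardSuperconductivity.Theorems.DispersionFlow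
open Summit.HubbardSuperconductivity.HubbardSuperconductivity.Theorems.PerturbedFermiCurve

/-! ## §1 The (R231) shares — arithmetic -/

/-- **The residue at the (R231) default shares fits `eremBar G P Q U β L n`**: Hd `≤ ½(α)`, ε-terms `≤ ½(α) + ½(β)` (envelope), born main `≤ ½(β)`,
`RL ≤ ½(γ)`, lattice `≤ ½(γ)`. -/
theorem residue_le_eremBar_of_shares (G : GeoConsts) (P : SplitConsts) (Q : EngConsts) (U β : ℝ) (L n : ℕ) {Hd Eps Born RL Lat : ℝ}
    (hHd : Hd ≤ 2⁻¹ * (G.cloc * (P.Klam * U) ^ 2 * (4 : ℝ) ^ (-(G.θ * n))))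
    (hEps : Eps ≤ 2⁻¹ * (G.cloc * (P.Klam * U) ^ 2 * (4 : ℝ) ^ (-(G.θ * n))) + 2⁻¹ * (Q.CR * (P.Klam * |U|) ^ 3 * ((2 : ℝ) ^ n)⁻¹))
    (hBorn : Born ≤ 2⁻¹ * (Q.CR * (P.Klam * |U|) ^ 3 * ((2 : ℝ) ^ n)⁻¹))
    (hRL : RL ≤ 2⁻¹ * (Q.CL β n / L)) (hLat : Lat ≤ 2⁻¹ * (Q.CL β n / L)) :
    Hd + Eps + Born + RL + Lat ≤ eremBar G P Q U β L n := by
  unfold eremBar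
  linarith

/-- The ε-envelope from the (α)-half choice (the pen's expectation: flatness `∝ Λₙ₊₁² ∝ 4⁻ⁿ` at `O(U²)`): `Eps ≤ ½(α)` and `0 ≤ (β)`. -/
theorem eps_envelope_of_alpha_half (G : GeoConsts) (P : SplitConsts) (Q : EngConsts) (U : ℝ) (n : ℕ) {Eps : ℝ} (hCR3 : 0 ≤ Q.CR * (P.Klam * |U|) ^ 3)
    (h : Eps ≤ 2⁻¹ * (G.cloc * (P.Klam * U) ^ 2 * (4 : ℝ) ^ (-(G.θ * n)))) :
    Eps ≤ 2⁻¹ * (G.cloc * (P.Klam * U) ^ 2 * (4 : ℝ) ^ (-(G.θ * n))) + 2⁻¹ * (Q.CR * (P.Klam * |U|) ^ 3 * ((2 : ℝ) ^ n)⁻¹) := by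
  have : 0 ≤ Q.CR * (P.Klam * |U|) ^ 3 * ((2 : ℝ) ^ n)⁻¹ := mul_nonneg hCR3 (by positivity)
  linarith

/-- The ε-envelope from the (β)-half choice (census `O(U³)·2⁻ⁿ`): `Eps ≤ ½(β)` and `0 ≤ (α)` (`0 ≤ G.cloc`). -/
theorem eps_envelope_of_beta_half (G : GeoConsts) (P : SplitConsts) (Q : EngConsts) (U : ℝ) (n : ℕ) {Eps : ℝ} (hcloc : 0 ≤ G.cloc)
    (h : Eps ≤ 2⁻¹ * (Q.CR * (P.Klam * |U|) ^ 3 * ((2 : ℝ) ^ n)⁻¹)) :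
    Eps ≤ 2⁻¹ * (G.cloc * (P.Klam * U) ^ 2 * (4 : ℝ) ^ (-(G.θ * n))) + 2⁻¹ * (Q.CR * (P.Klam * |U|) ^ 3 * ((2 : ℝ) ^ n)⁻¹) := by
  have h4 : 0 < (4 : ℝ) ^ (-(G.θ * n)) := Real.rpow_pos_of_pos (by norm_num) _
  have : 0 ≤ G.cloc * (P.Klam * U) ^ 2 * (4 : ℝ) ^ (-(G.θ * n)) := by positivity
  linarith

/-- `0 ≤ klEngGeo11.cloc` (from `klEngGeo11_wf`). -/
theorem klEngGeo11_cloc_nonneg : 0 ≤ klEngGeo11.cloc := klEngGeo11_wf.2.2.2.2.1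

/-! ## §2 The (E4)-sized shares: lattice and born main -/

/-- The two lattice terms of the capstone are ONE lattice term at the combined data `(L_A + L_Aˢ/2, A₀ + A₀ˢ/2)`. -/
theorem latticeTerms_eq_combined (n j L : ℕ) (LA A₀ LAS A₀S G : ℝ) :
    4 * ((96 * (512 * LA / klScale klE0 (n + 1) + 32 * A₀ * G * ((9 * (2 * (448 / 3 * Real.exp 2) + 8) + 4 * 8) + (65 * (8 * (16 : ℝ) ^ (j - (n + 1))) + 17408 / 3 * 1)) / klScale klE0 (n + 1) ^ 2)) / L) +
        2 * ((96 * (512 * LAS / klScale klE0 (n + 1) + 32 * A₀S * G * ((9 * (2 * (448 / 3 * Real.exp 2) + 8) + 4 * 8) + (65 * (8 * (16 : ℝ) ^ (j - (n + 1))) + 17408 / 3 * 1)) / klScale klE0 (n + 1) ^ 2)) / L) =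
      4 * (96 * (512 * (LA + LAS / 2) / klScale klE0 (n + 1) + 32 * (A₀ + A₀S / 2) * G * ((9 * (2 * (448 / 3 * Real.exp 2) + 8) + 4 * 8) + (65 * (8 * (16 : ℝ) ^ (j - (n + 1))) + 17408 / 3 * 1)) / klScale klE0 (n + 1) ^ 2)) / L := by
  ring

/-- **The lattice share, generic `Q`**: in the regime `n ≤ n_β`, if `(β²+1)·(2¹⁸(L_A + L_Aˢ/2) + 2³⁰(A₀ + A₀ˢ/2)·G·16^{j−(n+1)}) ≤ ½·Q.CL β n` then
`4·LAT₀/L + 2·LAT₀ˢ/L ≤ ½·(Q.CL β n / L)`. -/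
theorem latticeTerms_div_le_half_CL (Q : EngConsts) {β : ℝ} (hβ : klBetaMin ≤ β) {n : ℕ} (hn : n ≤ nScales β) (j L : ℕ)
    {A₀ LA A₀S LAS G : ℝ} (hA0 : 0 ≤ A₀) (hLA : 0 ≤ LA) (hA0S : 0 ≤ A₀S) (hLAS : 0 ≤ LAS) (hG : 0 ≤ G)
    (hfit : (β ^ 2 + 1) * (2 ^ 18 * (LA + LAS / 2) + 2 ^ 30 * (A₀ + A₀S / 2) * G * (16 : ℝ) ^ (j - (n + 1))) ≤ 2⁻¹ * Q.CL β n) :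
    4 * ((96 * (512 * LA / klScale klE0 (n + 1) + 32 * A₀ * G * ((9 * (2 * (448 / 3 * Real.exp 2) + 8) + 4 * 8) + (65 * (8 * (16 : ℝ) ^ (j - (n + 1))) + 17408 / 3 * 1)) / klScale klE0 (n + 1) ^ 2)) / L) +
        2 * ((96 * (512 * LAS / klScale klE0 (n + 1) + 32 * A₀S * G * ((9 * (2 * (448 / 3 * Real.exp 2) + 8) + 4 * 8) + (65 * (8 * (16 : ℝ) ^ (j - (n + 1))) + 17408 / 3 * 1)) / klScale klE0 (n + 1) ^ 2)) / L) ≤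
      2⁻¹ * (Q.CL β n / L) := by
  rw [latticeTerms_eq_combined]
  have h := latticeTerm_le_of_regime hβ hn j (A₀ := A₀ + A₀S / 2) (LA := LA + LAS / 2) (G := G) (by positivity) (by positivity) hG
  have hL : (0 : ℝ) ≤ L := Nat.cast_nonneg L
  rw [show 2⁻¹ * (Q.CL β n / L) = (2⁻¹ * Q.CL β n) / L by ring]
  exact div_le_div_of_nonneg_right (h.trans hfit) hL

/-- **The lattice DEMAND from the two (R231) size inequalities** at the plain member index `j = n+1`: `L_A + L_Aˢ/2 ≤ 2³⁹·Psq²Rsq²` and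
`(A₀ + A₀ˢ/2)·G ≤ 2²⁷·Psq²Rsq²` give `(β²+1)·(2¹⁸(L_A + L_Aˢ/2) + 2³⁰(A₀ + A₀ˢ/2)·G·16⁰) ≤ ½·Q.CL β n` for every `Q` whose `CL β n` dominates
`(klEngQ9c P R).CL β n = 2⁶⁰·Psq²·Rsq²·(β²+1)·4ⁿ`. -/
theorem latticeDemand_of_sizes (P : SplitConsts) (R : RenConsts) (Q : EngConsts) (β : ℝ) (n : ℕ) {A₀ LA A₀S LAS G : ℝ}
    (hLAs : LA + LAS / 2 ≤ 2 ^ 39 * (klEngPsq P ^ 2 * klEngRsq R ^ 2)) (hA0s : (A₀ + A₀S / 2) * G ≤ 2 ^ 27 * (klEngPsq P ^ 2 * klEngRsq R ^ 2))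
    (hQ : (klEngQ9c P R).CL β n ≤ Q.CL β n) :
    (β ^ 2 + 1) * (2 ^ 18 * (LA + LAS / 2) + 2 ^ 30 * (A₀ + A₀S / 2) * G * (16 : ℝ) ^ (n + 1 - (n + 1))) ≤ 2⁻¹ * Q.CL β n := by
  have hCL : (klEngQ9c P R).CL β n = 2 ^ 60 * klEngPsq P ^ 2 * klEngRsq R ^ 2 * (β ^ 2 + 1) * (4 : ℝ) ^ n := rfl
  rw [Nat.sub_self, pow_zero, mul_one]
  have hPR : 0 ≤ klEngPsq P ^ 2 * klEngRsq R ^ 2 := by positivity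
  have h4 : (1 : ℝ) ≤ (4 : ℝ) ^ n := one_le_pow₀ (by norm_num)
  have hb1 : 0 ≤ β ^ 2 + 1 := by positivity
  have hin : 2 ^ 18 * (LA + LAS / 2) + 2 ^ 30 * (A₀ + A₀S / 2) * G ≤ 2 ^ 58 * (klEngPsq P ^ 2 * klEngRsq R ^ 2) := by nlinarith
  have h1 : (β ^ 2 + 1) * (2 ^ 18 * (LA + LAS / 2) + 2 ^ 30 * (A₀ + A₀S / 2) * G) ≤ (β ^ 2 + 1) * (2 ^ 58 * (klEngPsq P ^ 2 * klEngRsq R ^ 2)) :=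
    mul_le_mul_of_nonneg_left hin hb1
  have h2 : (β ^ 2 + 1) * (2 ^ 58 * (klEngPsq P ^ 2 * klEngRsq R ^ 2)) ≤ 2⁻¹ * (klEngQ9c P R).CL β n := by
    rw [hCL]
    have : 0 ≤ (β ^ 2 + 1) * (klEngPsq P ^ 2 * klEngRsq R ^ 2) := mul_nonneg hb1 hPR
    nlinarith
  linarith

/-- **The born-main share**: `ZS₀ˢ·klE0 ≤ 2·Q.CR·(Klam|U|)³ ⇒ ZS₀ˢ·Λₙ₊₁ ≤ ½·(Q.CR·(Klam|U|)³·2⁻ⁿ)` (`born_main_le_CR_slot` at `s = ½`). -/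
theorem bornMain_le_half_CR (P : SplitConsts) (Q : EngConsts) (U : ℝ) {ZS : ℝ} (hCR3 : 0 ≤ Q.CR * (P.Klam * |U|) ^ 3) (n : ℕ)
    (hfit : ZS * klE0 ≤ 2 * (Q.CR * (P.Klam * |U|) ^ 3)) :
    ZS * klScale klE0 (n + 1) ≤ 2⁻¹ * (Q.CR * (P.Klam * |U|) ^ 3 * ((2 : ℝ) ^ n)⁻¹) :=
  born_main_le_CR_slot P Q U (s := 2⁻¹) (by norm_num) hCR3 n (by linarith)

/-! ## §3 The closer: the same-frame out-of-class increment in the BARS of (E2″-F)ₙ₊₁ -/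

section Model

variable (L M : ℕ) [NeZero L] [NeZero M] (β U μ : ℝ) (K : TrigPolyC4v) {a' b' : ℝ} (B : BandBounds a' b') {R : RenConsts} {N : ℕ} {Af : ℝ}

set_option maxHeartbeats 1600000 in -- ~80 literal binders passed through the capstone; plumbing + linear arithmetic only
/-- **THE (c)-OUT CLOSER — SAME-FRAME INCREMENT IN THE BARS** (module docstring): capstone + (R231) shares ⇒
`‖A_j(1) − A_j(0)‖(x,y) ≤ gainBar klEngGeo11 P U (n+1) ρpp ρd ρx + eremBar klEngGeo11 P Q U β L n + thermalBar klEngGeo11 P U β (n+1)`. -/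
theorem outClass_sameFrame_le_bars (hR : R.WF2) (hU : 0 < U) (hUu : U ≤ klTSU R) (hμC : μ ∈ klWindowC) (hK : FrameOK R U N μ K)
    (hβ : klBetaMin ≤ β) (hβL : β ≤ L) {n : ℕ} (hn : n ≤ nScales β) (hGL : 8 * (4 + 8 / 3 * R.Gfr 1 * U ^ 2) * β ≤ L) (hGU : 8 / 3 * R.Gfr 1 * U ^ 2 ≤ 1)
    (hAb : ∀ p : Momentum, ∀ j ≤ 2, ‖iteratedFDeriv ℝ j (frameShift K) p‖ ≤ Af) (hA : 4 * Af < B.Dtmin) (hA20 : 4 * Af ≤ 1 / 20) (hμ : μ ≤ -0.15)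
    (hlo : a' < μ - 4 * klScale klE0 (n + 1) - 4 * Af) (hhi : μ + 4 * klScale klE0 (n + 1) + 4 * Af < b')
    (hM : β * (4 * klScale klE0 (n + 1)) / (2 * Real.pi) + 1 ≤ M)
    (A A' : ℕ → TorusSite 2 L → ℝ → Matrix (TorusSite 2 L) (TorusSite 2 L) ℂ) (b' : ℕ → TorusSite 2 L → ℝ → TorusSite 2 L → ℂ)
    (hAdef : A = fun j Qm t => Matrix.of fun k k' : TorusSite 2 L => if k ∈ klBall L μ 0 ∧ k' ∈ klBall L μ 0 then
      vertexFn L M β (gaussConv ℂ (softCovOf L M β μ K (softSymbolCompl L M β μ K (n + 1) j) + hubbardCovAboveCT L M β μ 0 K (klScale klE0 (n + 1)) - hubbardCovAboveCT L M β μ 0 K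
              (klScale klE0 n + t * (klScale klE0 (n + 1) - klScale klE0 n))) (hubbardEffectiveActionCT L M β U μ 0 K (klScale klE0 n + t * (klScale klE0 (n + 1) - klScale klE0 n)))) 4
              ![(((omega0 M, k'), 0), 0), ((((omega0 M).rev, Qm - k'), 1), 0), ((((omega0 M).rev, Qm - k), 1), 1), (((omega0 M, k), 0), 1)]
      else 0)
    (hA'def : A' = fun j Qm t => Matrix.of fun k k' : TorusSite 2 L => if k ∈ klBall L μ 0 ∧ k' ∈ klBall L μ 0 then
      (klScale klE0 (n + 1) - klScale klE0 n) • -((2 : ℂ)⁻¹ * vertexFn L M β (gaussConv ℂ (softCovOf L M β μ K (softSymbolCompl L M β μ K (n + 1) j) + hubbardCovAboveCT L M β μ 0 K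
              (klScale klE0 (n + 1)) - hubbardCovAboveCT L M β μ 0 K (klScale klE0 n + t * (klScale klE0 (n + 1) - klScale klE0 n))) (grassmannDerivPairing ℂ (Matrix.of fun X Y :
              HubbardFieldIdx L M => deriv (fun Λ'' : ℝ => hubbardCovAboveCT L M β μ 0 K Λ'' X Y) (klScale klE0 n + t * (klScale klE0 (n + 1) - klScale klE0 n)))
              (hubbardEffectiveActionCT L M β U μ 0 K (klScale klE0 n + t * (klScale klE0 (n + 1) - klScale klE0 n))) (hubbardEffectiveActionCT L M β U μ 0 K (klScale klE0 n + t *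
              (klScale klE0 (n + 1) - klScale klE0 n))))) 4 ![(((omega0 M, k'), 0), 0), ((((omega0 M).rev, Qm - k'), 1), 0), ((((omega0 M).rev, Qm - k), 1), 1), (((omega0 M, k), 0),
              1)])
      else 0)
    (hb'def : b' = fun (j : ℕ) (Qm : TorusSite 2 L) (t : ℝ) (p : TorusSite 2 L) => (((klScale klE0 (n + 1) - klScale klE0 n) *
        (klBubbleMass L M β μ K (fun k => deriv (fun Λ' => hubbardCutoffWeightCT L M β μ K Λ' k) (klScale klE0 n + t * (klScale klE0 (n + 1) - klScale klE0 n))) (fun k =>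
                (softSymbolCompl L M β μ K (n + 1) j) k + (hubbardCutoffWeightCT L M β μ K (klScale klE0 (n + 1)) k - hubbardCutoffWeightCT L M β μ K (klScale klE0 n + t * (klScale
                klE0 (n + 1) - klScale klE0 n)) k)) Qm p +
          klBubbleMass L M β μ K (fun k => (softSymbolCompl L M β μ K (n + 1) j) k + (hubbardCutoffWeightCT L M β μ K (klScale klE0 (n + 1)) k - hubbardCutoffWeightCT L M β μ K
                  (klScale klE0 n + t * (klScale klE0 (n + 1) - klScale klE0 n)) k)) (fun k => deriv (fun Λ' => hubbardCutoffWeightCT L M β μ K Λ' k) (klScale klE0 n + t * (klScale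
                  klE0 (n + 1) - klScale klE0 n))) Qm p) : ℝ) : ℂ))
    (V : ℕ → ℝ → (Fin 4 → HubbardFieldIdx L M) → ℂ) (hV : V = fun j t X => vertexFn L M β (gaussConv ℂ (softCovOf L M β μ K (softSymbolCompl L M β μ K (n + 1) j) + hubbardCovAboveCT L
            M β μ 0 K (klScale klE0 (n + 1)) - hubbardCovAboveCT L M β μ 0 K (klScale klE0 n + t * (klScale klE0 (n + 1) - klScale klE0 n))) (hubbardEffectiveActionCT L M β U μ 0 K
            (klScale klE0 n + t * (klScale klE0 (n + 1) - klScale klE0 n)))) 4 X)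
    (V6 : ℕ → ℝ → (Fin 6 → HubbardFieldIdx L M) → ℂ) (hV6 : V6 = fun j t X => vertexFn L M β (gaussConv ℂ (softCovOf L M β μ K (softSymbolCompl L M β μ K (n + 1) j) + hubbardCovAboveCT
            L M β μ 0 K (klScale klE0 (n + 1)) - hubbardCovAboveCT L M β μ 0 K (klScale klE0 n + t * (klScale klE0 (n + 1) - klScale klE0 n))) (hubbardEffectiveActionCT L M β U μ 0 K
            (klScale klE0 n + t * (klScale klE0 (n + 1) - klScale klE0 n)))) 6 X)
    (Sg : ℕ → ℝ → FreqMomentum L M → Fin 2 → ℂ) (hSg : Sg = fun j t p σ => selfEnergy L M β (gaussConv ℂ (softCovOf L M β μ K (softSymbolCompl L M β μ K (n + 1) j) + hubbardCovAboveCT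
            L M β μ 0 K (klScale klE0 (n + 1)) - hubbardCovAboveCT L M β μ 0 K (klScale klE0 n + t * (klScale klE0 (n + 1) - klScale klE0 n))) (hubbardEffectiveActionCT L M β U μ 0 K
            (klScale klE0 n + t * (klScale klE0 (n + 1) - klScale klE0 n)))) p σ)
    (Hd : ℕ → ℝ → (Fin 4 → HubbardFieldIdx L M) → ℂ) (hHd : Hd = fun j t X => vertexFn L M β (dblFold ℂ (grassmannLaplacian ℂ (crossCov ℂ (Matrix.of fun X Y : HubbardFieldIdx L M =>
            deriv (fun Λ' : ℝ => hubbardCovAboveCT L M β μ 0 K Λ' X Y) (klScale klE0 n + t * (klScale klE0 (n + 1) - klScale klE0 n)))) ((gaussConv ℂ (crossCov ℂ (softCovOf L M β μ K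
            (softSymbolCompl L M β μ K (n + 1) j) + hubbardCovAboveCT L M β μ 0 K (klScale klE0 (n + 1)) - hubbardCovAboveCT L M β μ 0 K (klScale klE0 n + t * (klScale klE0 (n + 1) -
            klScale klE0 n)))) - grassmannLaplacian ℂ (crossCov ℂ (softCovOf L M β μ K (softSymbolCompl L M β μ K (n + 1) j) + hubbardCovAboveCT L M β μ 0 K (klScale klE0 (n + 1)) -
            hubbardCovAboveCT L M β μ 0 K (klScale klE0 n + t * (klScale klE0 (n + 1) - klScale klE0 n))))) (dblCopy ℂ 0 (gaussConv ℂ (softCovOf L M β μ K (softSymbolCompl L M β μ K (n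
            + 1) j) + hubbardCovAboveCT L M β μ 0 K (klScale klE0 (n + 1)) - hubbardCovAboveCT L M β μ 0 K (klScale klE0 n + t * (klScale klE0 (n + 1) - klScale klE0 n)))
            (hubbardEffectiveActionCT L M β U μ 0 K (klScale klE0 n + t * (klScale klE0 (n + 1) - klScale klE0 n)))) * dblCopy ℂ 1 (gaussConv ℂ (softCovOf L M β μ K (softSymbolCompl L
            M β μ K (n + 1) j) + hubbardCovAboveCT L M β μ 0 K (klScale klE0 (n + 1)) - hubbardCovAboveCT L M β μ 0 K (klScale klE0 n + t * (klScale klE0 (n + 1) - klScale klE0 n)))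
            (hubbardEffectiveActionCT L M β U μ 0 K (klScale klE0 n + t * (klScale klE0 (n + 1) - klScale klE0 n)))))))) 4 X)
    (Φ : ℕ → ℝ → FreqMomentum L M → ℝ) (hΦ : Φ = fun j t k => (softSymbolCompl L M β μ K (n + 1) j) k + (hubbardCutoffWeightCT L M β μ K (klScale klE0 (n + 1)) k -
            hubbardCutoffWeightCT L M β μ K (klScale klE0 n + t * (klScale klE0 (n + 1) - klScale klE0 n)) k))
    (Wd : ℝ → FreqMomentum L M → ℝ) (hWd : Wd = fun t k => deriv (fun Λ' : ℝ => hubbardCutoffWeightCT L M β μ K Λ' k) (klScale klE0 n + t * (klScale klE0 (n + 1) - klScale klE0 n)))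
    (Br : ℕ → TorusSite 2 L → ℝ → TorusSite 2 L × MatsubaraIdx M → ℂ) (hBr : Br = fun j Qm t z => -(((((β * (L : ℝ) ^ 2 : ℝ) : ℂ)))⁻¹ * propCT L M β μ K (z.2, z.1) * propCT L M β μ K
            (z.2.rev, Qm - z.1)) *
      ((((klScale klE0 (n + 1) - klScale klE0 n) * (-Wd t (z.2, z.1) * Φ j t (z.2.rev, Qm - z.1) - Φ j t (z.2, z.1) * Wd t (z.2.rev, Qm - z.1))) : ℝ) : ℂ))
    (j : ℕ) (hj : n + 1 ≤ j) {Qm : TorusSite 2 L} (hQ : ¬ IsPairClassAt L Qm (n + 1))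
    (hZ : ∀ Λ ∈ Icc (klScale klE0 (n + 1)) (klScale klE0 n), hubbardEffPartitionFnCT L M β U μ 0 K Λ ≠ 0)
    {P : SplitConsts} {m : ℝ} (hm0 : 0 ≤ m) (hm : m ^ 2 ≤ 2 ^ 8 * (P.Klam * U) ^ 2) (hAm : ∀ t ∈ Icc (0 : ℝ) 1, ∀ x y, ‖A j Qm t x y‖ ≤ m)
    (x y : TorusSite 2 L) {M4 RH RL : ℝ} (hM40 : 0 ≤ M4) (hM4 : ∀ t ∈ Icc (0 : ℝ) 1, ∀ X, ‖V j t X‖ ≤ M4)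
    (hM4K : M4 * M4 ≤ 2 ^ 3 * (P.Klam * U) ^ 2) (hM4KG : M4 * M4 * (4 + 8 / 3 * R.Gfr 1 * U ^ 2) ^ 2 ≤ 2 ^ 32 * (P.Klam * U) ^ 2)
    (hH : ∀ t ∈ Icc (0 : ℝ) 1, ‖Hd j t ![(((omega0 M, y), 0), 0), ((((omega0 M).rev, Qm - y), 1), 0), ((((omega0 M).rev, Qm - x), 1), 1), (((omega0 M, x), 0), 1)]‖ ≤ RH)
    (hL : ∀ t ∈ Icc (0 : ℝ) 1, ‖∑ z : TorusSite 2 L × MatsubaraIdx M, Br j Qm t z *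
          ((if z.1 ∈ klBall L μ 0 then
              V j t ![(((omega0 M, z.1), 0), 0), ((((omega0 M).rev, Qm - z.1), 1), 0), ((((omega0 M).rev, Qm - x), 1), 1), (((omega0 M, x), 0), 1)] *
                V j t ![(((omega0 M, y), 0), 0), ((((omega0 M).rev, Qm - y), 1), 0), ((((omega0 M).rev, Qm - z.1), 1), 1), (((omega0 M, z.1), 0), 1)]
            else 0) -
            V j t ![(((z.2, z.1), 0), 0), (((z.2.rev, Qm - z.1), 1), 0), ((((omega0 M).rev, Qm - x), 1), 1), (((omega0 M, x), 0), 1)] *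
              V j t ![(((omega0 M, y), 0), 0), ((((omega0 M).rev, Qm - y), 1), 0), (((z.2.rev, Qm - z.1), 1), 1), (((z.2, z.1), 0), 1)])‖ ≤ RL)
    {A₀ LA ε : ℝ} (hA0 : 0 ≤ A₀) (hLA : 0 ≤ LA) (hε : 0 ≤ ε)
    (hY0p : ∀ t ∈ Icc (0 : ℝ) 1, ∀ k : TorusSite 2 L, ‖∑ σ : Fin 2, V j t ![(((omega0 M, k), σ), 1), (((omega0 M, k + (x - y)), σ), 0), (((omega0 M, y), 0), 0), (((omega0 M, x), 0), 1)] *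
        V j t ![(((omega0 M, k), σ), 0), (((omega0 M, k + (x - y)), σ), 1), ((((omega0 M).rev, Qm - y), 1), 0), ((((omega0 M).rev, Qm - x), 1), 1)]‖ ≤ A₀)
    (hY1p : ∀ t ∈ Icc (0 : ℝ) 1, ∀ k k' : TorusSite 2 L, ‖(∑ σ : Fin 2, V j t ![(((omega0 M, k), σ), 1), (((omega0 M, k + (x - y)), σ), 0), (((omega0 M, y), 0), 0), (((omega0 M, x), 0), 1)] *
          V j t ![(((omega0 M, k), σ), 0), (((omega0 M, k + (x - y)), σ), 1), ((((omega0 M).rev, Qm - y), 1), 0), ((((omega0 M).rev, Qm - x), 1), 1)]) -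
        ∑ σ : Fin 2, V j t ![(((omega0 M, k'), σ), 1), (((omega0 M, k' + (x - y)), σ), 0), (((omega0 M, y), 0), 0), (((omega0 M, x), 0), 1)] *
          V j t ![(((omega0 M, k'), σ), 0), (((omega0 M, k' + (x - y)), σ), 1), ((((omega0 M).rev, Qm - y), 1), 0), ((((omega0 M).rev, Qm - x), 1), 1)]‖ ≤
        LA * klTorusNorm L (k - k'))
    (hY0m : ∀ t ∈ Icc (0 : ℝ) 1, ∀ k : TorusSite 2 L, ‖∑ σ : Fin 2, V j t ![(((omega0 M, k + -(x - y)), σ), 1), (((omega0 M, k), σ), 0), (((omega0 M, y), 0), 0), (((omega0 M, x), 0), 1)] *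
        V j t ![(((omega0 M, k + -(x - y)), σ), 0), (((omega0 M, k), σ), 1), ((((omega0 M).rev, Qm - y), 1), 0), ((((omega0 M).rev, Qm - x), 1), 1)]‖ ≤ A₀)
    (hY1m : ∀ t ∈ Icc (0 : ℝ) 1, ∀ k k' : TorusSite 2 L, ‖(∑ σ : Fin 2, V j t ![(((omega0 M, k + -(x - y)), σ), 1), (((omega0 M, k), σ), 0), (((omega0 M, y), 0), 0), (((omega0 M, x), 0), 1)] *
          V j t ![(((omega0 M, k + -(x - y)), σ), 0), (((omega0 M, k), σ), 1), ((((omega0 M).rev, Qm - y), 1), 0), ((((omega0 M).rev, Qm - x), 1), 1)]) -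
        ∑ σ : Fin 2, V j t ![(((omega0 M, k' + -(x - y)), σ), 1), (((omega0 M, k'), σ), 0), (((omega0 M, y), 0), 0), (((omega0 M, x), 0), 1)] *
          V j t ![(((omega0 M, k' + -(x - y)), σ), 0), (((omega0 M, k'), σ), 1), ((((omega0 M).rev, Qm - y), 1), 0), ((((omega0 M).rev, Qm - x), 1), 1)]‖ ≤
        LA * klTorusNorm L (k - k'))
    (hflat : ∀ t ∈ Icc (0 : ℝ) 1, ∀ (i : MatsubaraIdx M) (σ : Fin 2) (k k' : TorusSite 2 L), matsubaraFreq β M i ^ 2 ≤ (4 * klScale klE0 (n + 1)) ^ 2 →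
      ‖V j t ![(((i, k), σ), 1), (((i, k'), σ), 0), (((omega0 M, y), 0), 0), (((omega0 M, x), 0), 1)] *
            V j t ![(((i, k), σ), 0), (((i, k'), σ), 1), ((((omega0 M).rev, Qm - y), 1), 0), ((((omega0 M).rev, Qm - x), 1), 1)] -
          V j t ![(((omega0 M, k), σ), 1), (((omega0 M, k'), σ), 0), (((omega0 M, y), 0), 0), (((omega0 M, x), 0), 1)] *
            V j t ![(((omega0 M, k), σ), 0), (((omega0 M, k'), σ), 1), ((((omega0 M).rev, Qm - y), 1), 0), ((((omega0 M).rev, Qm - x), 1), 1)]‖ ≤ ε)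
    (hY0B : ∀ t ∈ Icc (0 : ℝ) 1, ∀ k : TorusSite 2 L, ‖V j t ![(((omega0 M, k), 0), 1), ((((omega0 M).rev, k + (Qm - x - y)), 1), 0), (((omega0 M, y), 0), 0), ((((omega0 M).rev, Qm - x), 1), 1)] *
        V j t ![(((omega0 M, k), 0), 0), ((((omega0 M).rev, k + (Qm - x - y)), 1), 1), ((((omega0 M).rev, Qm - y), 1), 0), (((omega0 M, x), 0), 1)]‖ ≤ A₀)
    (hY1B : ∀ t ∈ Icc (0 : ℝ) 1, ∀ k k' : TorusSite 2 L,
      ‖V j t ![(((omega0 M, k), 0), 1), ((((omega0 M).rev, k + (Qm - x - y)), 1), 0), (((omega0 M, y), 0), 0), ((((omega0 M).rev, Qm - x), 1), 1)] *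
            V j t ![(((omega0 M, k), 0), 0), ((((omega0 M).rev, k + (Qm - x - y)), 1), 1), ((((omega0 M).rev, Qm - y), 1), 0), (((omega0 M, x), 0), 1)] -
          V j t ![(((omega0 M, k'), 0), 1), ((((omega0 M).rev, k' + (Qm - x - y)), 1), 0), (((omega0 M, y), 0), 0), ((((omega0 M).rev, Qm - x), 1), 1)] *
            V j t ![(((omega0 M, k'), 0), 0), ((((omega0 M).rev, k' + (Qm - x - y)), 1), 1), ((((omega0 M).rev, Qm - y), 1), 0), (((omega0 M, x), 0), 1)]‖ ≤
        LA * klTorusNorm L (k - k'))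
    (hY0A : ∀ t ∈ Icc (0 : ℝ) 1, ∀ k : TorusSite 2 L, ‖V j t ![(((omega0 M, k + -(Qm - x - y)), 0), 1), ((((omega0 M).rev, k), 1), 0), (((omega0 M, y), 0), 0), ((((omega0 M).rev, Qm - x), 1), 1)] *
        V j t ![(((omega0 M, k + -(Qm - x - y)), 0), 0), ((((omega0 M).rev, k), 1), 1), ((((omega0 M).rev, Qm - y), 1), 0), (((omega0 M, x), 0), 1)]‖ ≤ A₀)
    (hY1A : ∀ t ∈ Icc (0 : ℝ) 1, ∀ k k' : TorusSite 2 L,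
      ‖V j t ![(((omega0 M, k + -(Qm - x - y)), 0), 1), ((((omega0 M).rev, k), 1), 0), (((omega0 M, y), 0), 0), ((((omega0 M).rev, Qm - x), 1), 1)] *
            V j t ![(((omega0 M, k + -(Qm - x - y)), 0), 0), ((((omega0 M).rev, k), 1), 1), ((((omega0 M).rev, Qm - y), 1), 0), (((omega0 M, x), 0), 1)] -
          V j t ![(((omega0 M, k' + -(Qm - x - y)), 0), 1), ((((omega0 M).rev, k'), 1), 0), (((omega0 M, y), 0), 0), ((((omega0 M).rev, Qm - x), 1), 1)] *
            V j t ![(((omega0 M, k' + -(Qm - x - y)), 0), 0), ((((omega0 M).rev, k'), 1), 1), ((((omega0 M).rev, Qm - y), 1), 0), (((omega0 M, x), 0), 1)]‖ ≤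
        LA * klTorusNorm L (k - k'))
    (hflatX : ∀ t ∈ Icc (0 : ℝ) 1, ∀ (i i' : MatsubaraIdx M) (k k' : TorusSite 2 L), matsubaraInt M i' + 1 = matsubaraInt M i →
      matsubaraFreq β M i ^ 2 ≤ (5 * klScale klE0 (n + 1)) ^ 2 →
      ‖V j t ![(((i, k), 0), 1), (((i', k'), 1), 0), (((omega0 M, y), 0), 0), ((((omega0 M).rev, Qm - x), 1), 1)] *
            V j t ![(((i, k), 0), 0), (((i', k'), 1), 1), ((((omega0 M).rev, Qm - y), 1), 0), (((omega0 M, x), 0), 1)] -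
          V j t ![(((omega0 M, k), 0), 1), ((((omega0 M).rev, k'), 1), 0), (((omega0 M, y), 0), 0), ((((omega0 M).rev, Qm - x), 1), 1)] *
            V j t ![(((omega0 M, k), 0), 0), ((((omega0 M).rev, k'), 1), 1), ((((omega0 M).rev, Qm - y), 1), 0), (((omega0 M, x), 0), 1)]‖ ≤ ε)
    {A₀S LAS εS : ℝ} (hA0S : 0 ≤ A₀S) (hLAS : 0 ≤ LAS) (hεS : 0 ≤ εS)
    (hY0S : ∀ t ∈ Icc (0 : ℝ) 1, ∀ k : TorusSite 2 L, ‖∑ σ : Fin 2, V6 j t ![(((omega0 M, k), σ), 0), (((omega0 M, k), σ), 1), (((omega0 M, y), 0), 0), ((((omega0 M).rev, Qm - y), 1), 0),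
        ((((omega0 M).rev, Qm - x), 1), 1), (((omega0 M, x), 0), 1)] * Sg j t (omega0 M, k) σ‖ ≤ A₀S)
    (hY1S : ∀ t ∈ Icc (0 : ℝ) 1, ∀ k k' : TorusSite 2 L, ‖(∑ σ : Fin 2, V6 j t ![(((omega0 M, k), σ), 0), (((omega0 M, k), σ), 1), (((omega0 M, y), 0), 0), ((((omega0 M).rev, Qm - y), 1), 0),
          ((((omega0 M).rev, Qm - x), 1), 1), (((omega0 M, x), 0), 1)] * Sg j t (omega0 M, k) σ) -
        ∑ σ : Fin 2, V6 j t ![(((omega0 M, k'), σ), 0), (((omega0 M, k'), σ), 1), (((omega0 M, y), 0), 0), ((((omega0 M).rev, Qm - y), 1), 0),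
          ((((omega0 M).rev, Qm - x), 1), 1), (((omega0 M, x), 0), 1)] * Sg j t (omega0 M, k') σ‖ ≤ LAS * klTorusNorm L (k - k'))
    (hflatS : ∀ t ∈ Icc (0 : ℝ) 1, ∀ (i : MatsubaraIdx M) (σ : Fin 2) (k : TorusSite 2 L), matsubaraFreq β M i ^ 2 ≤ (4 * klScale klE0 (n + 1)) ^ 2 →
      ‖V6 j t ![(((i, k), σ), 0), (((i, k), σ), 1), (((omega0 M, y), 0), 0), ((((omega0 M).rev, Qm - y), 1), 0), ((((omega0 M).rev, Qm - x), 1), 1),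
              (((omega0 M, x), 0), 1)] * Sg j t (i, k) σ -
          V6 j t ![(((omega0 M, k), σ), 0), (((omega0 M, k), σ), 1), (((omega0 M, y), 0), 0), ((((omega0 M).rev, Qm - y), 1), 0), ((((omega0 M).rev, Qm - x), 1), 1),
              (((omega0 M, x), 0), 1)] * Sg j t (omega0 M, k) σ‖ ≤ εS)
    (hTHS : (393216 / Real.pi * (64 * (klScale klE0 (n + 1) / klScale klE0 j) ^ 2 + (2 * (448 / 3 * Real.exp 2) + 8) + 64) * (2 * A₀S * (Real.pi * Real.sqrt 2 / (B.Dtmin - 4 * Af)))) ≤ 2 ^ 77 * (P.Klam * U) ^ 2)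
    (hZS : (524288 / Real.pi * (64 * (klScale klE0 (n + 1) / klScale klE0 j) ^ 2 + (2 * (448 / 3 * Real.exp 2) + 8) + 64) * (Real.pi * Real.sqrt 2 / (B.Dtmin - 4 * Af) * (2 * LA + 2 * A₀ * (2 / (1 / 10))) / (B.Dtmin - 4 * Af) + 2 * A₀ * (1 / (B.Dtmin - 4 * Af) ^ 2 + Real.pi * Real.sqrt 2 * (2 + 4 * Af) / (B.Dtmin - 4 * Af) ^ 3))) ≤ 2 ^ 52 * (P.Klam * U) ^ 2)
    (hTH : (393216 / Real.pi * (64 * (klScale klE0 (n + 1) / klScale klE0 j) ^ 2 + (2 * (448 / 3 * Real.exp 2) + 8) + 64) * (2 * A₀ * (Real.pi * Real.sqrt 2 / (B.Dtmin - 4 * Af)))) ≤ 2 ^ 76 * (P.Klam * U) ^ 2)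
    (hTHR : (393216 / Real.pi * (64 * (klScale klE0 (n + 1) / klScale klE0 j) ^ 2 + (2 * (448 / 3 * Real.exp 2) + 8) + 64) * (2 * A₀ * (Real.pi * Real.sqrt 2 / (B.Dtmin - 4 * Af)))) + 2 * (256 / Real.pi * 8 * (2 * A₀ * (Real.pi * Real.sqrt 2 / (B.Dtmin - 4 * Af))) * (65 * (8 * (16 : ℝ) ^ (j - (n + 1))) + 17408 / 3 * 1)) ≤ 2 ^ 76 * (P.Klam * U) ^ 2)
    (hTR : (256 / Real.pi * 8 * (2 * A₀ * (Real.pi * Real.sqrt 2 / (B.Dtmin - 4 * Af))) * (65 * (8 * (16 : ℝ) ^ (j - (n + 1))) + 17408 / 3 * 1)) * (4 + 8 / 3 * R.Gfr 1 * U ^ 2) ≤ 2 ^ 52 * (P.Klam * U) ^ 2)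
    (Q : EngConsts) (hKlam : 0 ≤ P.Klam) (hCR : 0 ≤ Q.CR)
    (hShareHd : (klScale klE0 n - klScale klE0 (n + 1)) * (2⁻¹ * RH) ≤ 2⁻¹ * (klEngGeo11.cloc * (P.Klam * U) ^ 2 * (4 : ℝ) ^ (-(klEngGeo11.θ * n))))
    (hShareRL : RL ≤ 2⁻¹ * (Q.CL β n / L))
    (hShareLat : (β ^ 2 + 1) * (2 ^ 18 * (LA + LAS / 2) + 2 ^ 30 * (A₀ + A₀S / 2) * (4 + 8 / 3 * R.Gfr 1 * U ^ 2) * (16 : ℝ) ^ (j - (n + 1))) ≤ 2⁻¹ * Q.CL β n)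
    (hShareBorn : (524288 / Real.pi * (64 * (klScale klE0 (n + 1) / klScale klE0 j) ^ 2 + (2 * (448 / 3 * Real.exp 2) + 8) + 64) * (Real.pi * Real.sqrt 2 / (B.Dtmin - 4 * Af) * (2 * LAS + 2 * A₀S * (2 / (1 / 10))) / (B.Dtmin - 4 * Af) + 2 * A₀S * (1 / (B.Dtmin - 4 * Af) ^ 2 + Real.pi * Real.sqrt 2 * (2 + 4 * Af) / (B.Dtmin - 4 * Af) ^ 3))) * klE0 ≤ 2 * (Q.CR * (P.Klam * |U|) ^ 3))
    (hShareEps : 2 * (ε * (2048 * 15367)) + 2 * (εS * (2048 * 15367)) ≤ 2⁻¹ * (klEngGeo11.cloc * (P.Klam * U) ^ 2 * (4 : ℝ) ^ (-(klEngGeo11.θ * n))) + 2⁻¹ * (Q.CR * (P.Klam * |U|) ^ 3 * ((2 : ℝ) ^ n)⁻¹)) :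
    ‖A j Qm 1 x y - A j Qm 0 x y‖ ≤
      gainBar klEngGeo11 P U (n + 1) (klTorusNorm L Qm) (klTorusNorm L (x - y)) (klTorusNorm L (x + y - Qm)) +
        eremBar klEngGeo11 P Q U β L n + thermalBar klEngGeo11 P U β (n + 1) := by
  have hGfr' : ∀ j, 0 ≤ R.Gfr j := hR.wf.2.2
  have hG0 : 0 ≤ (4 + 8 / 3 * R.Gfr 1 * U ^ 2) := by have := hGfr' 1; positivity
  have hcap := outClass_sameFrame_le_slots_signedBorn L M β U μ K B hR hU hUu hμC hK hβ hβL hn hGL hGU hAb hA hA20 hμ hlo hhi hM A A' b' hAdef hA'def hb'def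
    V hV V6 hV6 Sg hSg Hd hHd Φ hΦ Wd hWd Br hBr j hj hQ hZ hm0 hm hAm x y hM40 hM4 hM4K hM4KG hH hL hA0 hLA hε hY0p hY1p hY0m hY1m hflat hY0B hY1B hY0A hY1A
    hflatX hA0S hLAS hεS hY0S hY1S hflatS hTHS hZS hTH hTHR hTR
  have hlat' := latticeTerms_div_le_half_CL Q hβ hn j L hA0 hLA hA0S hLAS hG0 hShareLat
  have hCR3 : 0 ≤ Q.CR * (P.Klam * |U|) ^ 3 := by positivity
  have hborn' := bornMain_le_half_CR P Q U hCR3 n hShareBorn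
  have hsum := residue_le_eremBar_of_shares klEngGeo11 P Q U β L n hShareHd hShareEps hborn' hShareRL hlat'
  linarith only [hcap, hlat', hborn', hsum]

end Model

end Summit.HubbardSuperconductivity.HubbardSuperconductivity.Theorems.KLRegimeSplit

end
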